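import Literature.Geometry.Symplectic.ContactTypeSmallSpheres
import Literature.Topology.FourManifolds.ConnectedSumData
import Literature.Topology.FourManifolds.UnorientedDiscTheorem
import Summits.SmoothPoincare4.SmoothPoincare4.Theorems.SymplecticOrigamiOrigamiFoldExistenceHelperInChartSymplecticPackage
import Summits.SmoothPoincare4.SmoothPoincare4.Theorems.SymplecticOrigamiOrigamiFoldExistenceHelperStabilityInvariances
import Mathlib.Analysis.InnerProductSpace.Calculus
import Mathlib.Analysis.SpecialFunctions.Sqrt

/-!
# Line `stable-seam-host` (crux `OrigamiFoldExistence`, stmt-SmoothPoincare4-7844): SR HOLDS AT EVERY SEAM BOUNDING A BALL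

Lead c10, cycle 2.  The research stub SR (`stub_stableRepresentative`) is used by the line only at
seams of FAKE balls; its KNOWN RUNG — the conclusion of SR for every 3-sphere bounding a smoothly
embedded ball — is proved here for ANY symplectic `ℝ⁴`-charted `(X, Ω)`:
`helper_exists_stable_disc` (every point is the centre of a disc `(chartAt x₀).symm ∘ univBall c ρ'`
whose unit-sphere trace `k² Ωc(c + k u)`, `Ωc = Ω.inChart x₀`, `k = ρ'/√2`, is stabilised by the
Literature theorem `exists_isStabilising_smallSphere` — local Liouville primitive, Poincaré lemma,
Pfaffian perturbation; `helper_inChart_symplectic_package`, `helper_isStabilising_of_tangential_eq_smul`)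
and `helper_stableRepresentative_of_disc` (unoriented disc theorem
`exists_diffeomorph_apply_disc_eq_or_reflect_of_model`: `φ ∘ G = i` or `i ∘ ρ` on the closed unit
ball; `helper_mfderiv_eq_of_eqOn_closedBall`, `helper_isStabilising_comp_linearIsometry`).
No definitions, no named facts, no `sorry`.  McDuff–Salamon (2017) §3.5; Palais 1960 Thm B.
-/

noncomputable section

-- the prescribed namespace `Summit.<P>.<Sub>.…` duplicates `SmoothPoincare4` (P = Sub)
set_option linter.dupNamespace false

open scoped Manifold ContDiff Topology RealInnerProductSpace
open Set Function Metric OpenPartialHomeomorph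

namespace Summit.SmoothPoincare4.SmoothPoincare4.Theorems.OrigamiFoldExistence.StableSeamHost

open Literature.Geometry.Symplectic Literature.Geometry.Kaehler Literature.Topology.FourManifolds

/-! ### The squeeze `univBall c r` on the unit sphere -/

/-- The formula for Mathlib's squeeze of `ℝ⁴` onto the ball `B(c, r)`, `r > 0`:
`univBall c r x = r • (√(1 + ‖x‖²))⁻¹ • x + c`. [folklore] -/
theorem univBall_apply_eq (c : EuclideanSpace ℝ (Fin 4)) {r : ℝ} (hr : 0 < r)
    (x : EuclideanSpace ℝ (Fin 4)) :
    univBall c r x = r • ((Real.sqrt (1 + ‖x‖ ^ 2))⁻¹ • x) + c := by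
  rw [univBall, dif_pos hr]
  rfl

/-- The derivative of the squeeze at a point `u` of the unit sphere, on vectors `v ⊥ u`, is the
dilation by `r / √2` (the radial factor has vanishing derivative in tangential directions).
[folklore] -/
theorem fderiv_univBall_of_inner_eq_zero (c : EuclideanSpace ℝ (Fin 4)) {r : ℝ} (hr : 0 < r)
    {u v : EuclideanSpace ℝ (Fin 4)} (hu : ‖u‖ = 1) (hvu : ⟪v, u⟫ = 0) :
    fderiv ℝ (univBall c r) u v = (r * (Real.sqrt 2)⁻¹) • v := by
  -- the radial factor `g x = (√(1 + ‖x‖²))⁻¹` and its derivative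
  set g : EuclideanSpace ℝ (Fin 4) → ℝ := fun x => (Real.sqrt (1 + ‖x‖ ^ 2))⁻¹ with hg
  have hN : HasFDerivAt (fun x : EuclideanSpace ℝ (Fin 4) => 1 + ‖x‖ ^ 2)
      (2 • (innerSL ℝ u : EuclideanSpace ℝ (Fin 4) →L[ℝ] ℝ)) u :=
    (hasStrictFDerivAt_norm_sq u).hasFDerivAt.const_add 1
  have hpos : 0 < 1 + ‖u‖ ^ 2 := by positivity
  have hh : HasDerivAt (fun t : ℝ => (Real.sqrt t)⁻¹)
      (-(1 / (2 * Real.sqrt (1 + ‖u‖ ^ 2))) / (Real.sqrt (1 + ‖u‖ ^ 2)) ^ 2) (1 + ‖u‖ ^ 2) :=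
    (Real.hasDerivAt_sqrt hpos.ne').inv (Real.sqrt_ne_zero'.2 hpos)
  have hgd := hh.hasFDerivAt.comp u hN
  have hgfun : g = ((fun t : ℝ => (Real.sqrt t)⁻¹) ∘ fun x : EuclideanSpace ℝ (Fin 4) => 1 + ‖x‖ ^ 2) :=
    rfl
  have hvu' : ⟪u, v⟫ = 0 := by rw [real_inner_comm]; exact hvu
  have hgv : fderiv ℝ g u v = 0 := by
    rw [hgfun, hgd.fderiv]
    simp [hvu']
  have hgdiff : DifferentiableAt ℝ g u := by rw [hgfun]; exact hgd.differentiableAt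
  -- the squeeze `x ↦ r • (g x • x) + c`
  have hU : HasFDerivAt (fun x : EuclideanSpace ℝ (Fin 4) => r • (g x • x) + c)
      (r • (g u • ContinuousLinearMap.id ℝ _ + (fderiv ℝ g u).smulRight u)) u :=
    ((hgdiff.hasFDerivAt.smul (hasFDerivAt_id u)).const_smul r).add_const c
  have hfun : univBall c r = fun x : EuclideanSpace ℝ (Fin 4) => r • (g x • x) + c := by
    funext x; rw [univBall_apply_eq c hr x]
  rw [hfun, hU.fderiv]
  have hgu : g u = (Real.sqrt 2)⁻¹ := by
    simp only [hg, hu, one_pow]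
    norm_num
  simp only [FunLike.coe_smul, Pi.smul_apply, add_apply, ContinuousLinearMap.coe_id', id_eq,
    ContinuousLinearMap.smulRight_apply, hgv, zero_smul, add_zero, smul_smul, hgu]

/-- The value of the squeeze at a unit vector: `univBall c r u = c + (r/√2) u`. [folklore] -/
theorem univBall_apply_of_norm_eq_one (c : EuclideanSpace ℝ (Fin 4)) {r : ℝ} (hr : 0 < r)
    {u : EuclideanSpace ℝ (Fin 4)} (hu : ‖u‖ = 1) :
    univBall c r u = c + (r * (Real.sqrt 2)⁻¹) • u := by
  rw [univBall_apply_eq c hr u, hu, one_pow, smul_smul, add_comm]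
  norm_num

/-- Congruence of a 2-form value in its two vector arguments (early copy). [folklore] -/
theorem two_form_congr_vec' {X : Type} [TopologicalSpace X] [ChartedSpace (EuclideanSpace ℝ (Fin 4)) X]
    (Ω : Literature.Geometry.Kaehler.MForm (𝓡 4) X ℝ 2) (p : X) (a b a' b' : EuclideanSpace ℝ (Fin 4))
    (ha : a = a') (hb : b = b') : Ω p ![a, b] = Ω p ![a', b'] := by
  subst ha; subst hb; rfl

/-! ### A disc inside a chart -/

/-- **A disc from a chart ball.**  If `B(c, r) ⊆ (chartAt x₀).target`, then
`i = (chartAt x₀).symm ∘ univBall c r : ℝ⁴ → X` is a smooth embedding of the model space (the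
inverse of the chart `chartAt x₀ ≫ₕ (univBall c r).symm` of the maximal atlas, whose target is all
of `ℝ⁴`; Kosinski VI.1 "disc embeddings"). [cite: Kosinski1993, Ch. VI §1] -/
theorem isSmoothEmbedding_chart_symm_comp_univBall {X : Type} [TopologicalSpace X]
    [ChartedSpace (EuclideanSpace ℝ (Fin 4)) X] [IsManifold (𝓡 4) ∞ X] (x₀ : X)
    (c : EuclideanSpace ℝ (Fin 4)) {r : ℝ} (hr : 0 < r)
    (hball : ball c r ⊆ (chartAt (EuclideanSpace ℝ (Fin 4)) x₀).target) :
    Manifold.IsSmoothEmbedding (𝓡 4) (𝓡 4) ∞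
      ((chartAt (EuclideanSpace ℝ (Fin 4)) x₀).symm ∘ univBall c r) := by
  set e₀ := chartAt (EuclideanSpace ℝ (Fin 4)) x₀ with he₀
  set w := univBall c r with hw
  have hwt : w.target = ball c r := univBall_target _ hr
  have h₀ := IsManifold.chart_mem_maximalAtlas (I := 𝓘(ℝ, EuclideanSpace ℝ (Fin 4))) (n := ∞) x₀
  have hmem : e₀ ≫ₕ w.symm ∈ IsManifold.maximalAtlas 𝓘(ℝ, EuclideanSpace ℝ (Fin 4)) ∞ X := by
    apply OpenPartialHomeomorph.mem_maximalAtlas_of_contMDiffOn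
    · rw [trans_source, coe_trans, symm_source, hwt]
      exact contDiffOn_univBall_symm.contMDiffOn.comp
        ((contMDiffOn_of_mem_maximalAtlas h₀).mono inter_subset_left) fun y hy => hy.2
    · rw [trans_symm_eq_symm_trans_symm, symm_symm]
      exact (contMDiffOn_symm_of_mem_maximalAtlas h₀).comp contDiff_univBall.contMDiff.contMDiffOn
        fun y hy => hy.2
  have htgt : (e₀ ≫ₕ w.symm).target = univ := by
    rw [trans_target, symm_target, univBall_source, univ_inter, eq_univ_iff_forall]
    intro y
    exact hball (hwt ▸ w.map_source (by simp [hw]))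
  have h := isSmoothEmbedding_symm_of_target_eq_univ hmem htgt
  have hcoe : ⇑(e₀ ≫ₕ w.symm).symm = e₀.symm ∘ w := by
    funext y; rfl
  rwa [hcoe] at h

/-! ### The stable disc at every point -/

/-- **EVERY POINT OF A SYMPLECTIC 4-MANIFOLD IS THE CENTRE OF A DISC WITH STABILISED BOUNDARY
SPHERE** (registered helper): for a symplectic `MForm` `Ω` on the `ℝ⁴`-charted `X` and `x₀ : X`
there are a disc `i : ℝ⁴ → X` (`Manifold.IsSmoothEmbedding`, `i 0 = x₀`) and a global smooth `θ`
satisfying the two stability clauses for the trace of `i` on the unit sphere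
(`i = (chartAt x₀).symm ∘ univBall c ρ'`; trace `k² · (Ω.inChart x₀)(c + k u)`, `k = ρ'/√2`;
`exists_isStabilising_smallSphere`).  McDuff–Salamon (2017) §3.5. [cite: McDuffSalamon2017, §3.5] -/
theorem helper_exists_stable_disc :
    ∀ (X : Type) [TopologicalSpace X] [T2Space X] [ChartedSpace (EuclideanSpace ℝ (Fin 4)) X] [IsManifold (𝓡 4) ∞ X] (Ω : Literature.Geometry.Kaehler.MForm (𝓡 4) X ℝ 2), (Literature.Geometry.Kaehler.IsSmoothForm Ω ∧ Literature.Geometry.Kaehler.IsClosedForm Ω ∧ ∀ x (v : TangentSpace (𝓡 4) x), v ≠ 0 → ∃ w, Ω x ![v, w] ≠ 0) → ∀ x₀ : X, ∃ (i : EuclideanSpace ℝ (Fin 4) → X) (θ : EuclideanSpace ℝ (Fin 4) → EuclideanSpace ℝ (Fin 4) →L[ℝ] ℝ), Manifold.IsSmoothEmbedding (𝓡 4) (𝓡 4) ∞ i ∧ i 0 = x₀ ∧ (ContDiff ℝ ∞ θ ∧ (∀ u : EuclideanSpace ℝ (Fin 4), ‖u‖ = 1 → ∀ v : Fin 3 →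 EuclideanSpace ℝ (Fin 4), (∀ i, ⟪v i, u⟫ = 0) → LinearIndependent ℝ v → θ u (v 0) * Ω (i u) ![mfderiv (𝓡 4) (𝓡 4) i u (v 1), mfderiv (𝓡 4) (𝓡 4) i u (v 2)] - θ u (v 1) * Ω (i u) ![mfderiv (𝓡 4) (𝓡 4) i u (v 0), mfderiv (𝓡 4) (𝓡 4) i u (v 2)] + θ u (v 2) * Ω (i u) ![mfderiv (𝓡 4) (𝓡 4) i u (v 0), mfderiv (𝓡 4) (𝓡 4) i u (v 1)] ≠ 0) ∧ (∀ u : EuclideanSpace ℝ (Fin 4), ‖u‖ = 1 → ∀ v : EuclideanSpace ℝ (Fin 4), ⟪v, u⟫ = 0 → (∀ w : EuclideanSpace ℝ (Fin 4), ⟪w, u⟫ = 0 → Ω (i u) ![mfderiv (𝓡 4) (𝓡 4) i u v, mfderiv (𝓡 4) (𝓡 4) i u w] = 0) → ∀ w : EuclideanSpace ℝ (Fin 4), ⟪w, u⟫ = 0 → fderiv ℝ θ u v w - fderiv ℝ θ u w v = 0)) := by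
  intro X _ _ _ _ Ω hΩ x₀
  -- the chart, its centre and a ball in the target
  set e₀ := chartAt (EuclideanSpace ℝ (Fin 4)) x₀ with he₀
  set c : EuclideanSpace ℝ (Fin 4) := e₀ x₀ with hc
  have hct : c ∈ e₀.target := by simp [hc, he₀]
  obtain ⟨ρ, hρ, hballρ⟩ := Metric.isOpen_iff.1 e₀.open_target c hct
  -- the chart representative and its package (in `extChartAt` spelling)
  obtain ⟨hsm, hcl, hnd, happly⟩ := helper_inChart_symplectic_package X Ω hΩ x₀
  have htarget : (extChartAt (𝓡 4) x₀).target = e₀.target := by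
    simp [he₀]
  have hsymm : ∀ y, (extChartAt (𝓡 4) x₀).symm y = e₀.symm y := by
    intro y; rw [he₀]; simp
  set Ωc := Ω.inChart x₀ with hΩc
  have hs' : ContDiffOn ℝ ∞ Ωc (ball c ρ) := hsm.mono (htarget ▸ hballρ)
  have hcl' : ∀ y ∈ ball c ρ, extDeriv Ωc y = 0 := fun y hy => hcl y (htarget ▸ hballρ hy)
  have hnd' : ∀ y ∈ ball c ρ, ∀ v : EuclideanSpace ℝ (Fin 4), v ≠ 0 → ∃ w, Ωc y ![v, w] ≠ 0 :=
    fun y hy v hv => hnd y (htarget ▸ hballρ hy) v hv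
  -- small spheres are stabilised: radius `k`
  obtain ⟨r₁, hr₁, hstab⟩ := exists_isStabilising_smallSphere Ωc c ρ hρ hs' hcl' hnd'
  set k : ℝ := min (ρ / 2) (r₁ / 2) with hk
  have hk0 : 0 < k := lt_min (by linarith) (by linarith)
  have hkρ : k ≤ ρ / 2 := min_le_left _ _
  have hkr : k < r₁ := lt_of_le_of_lt (min_le_right _ _) (by linarith)
  obtain ⟨θ, hθ, h1, h2⟩ := hstab k hk0 hkr
  -- the squeeze radius `ρ' = k √2` and the disc
  set ρ' : ℝ := k * Real.sqrt 2 with hρ'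
  have hρ'0 : 0 < ρ' := by positivity
  have hkρ' : ρ' * (Real.sqrt 2)⁻¹ = k := by
    rw [hρ']; field_simp
  have hsqrt2 : Real.sqrt 2 < 2 := by
    rw [show (2 : ℝ) = Real.sqrt 4 by rw [show (4 : ℝ) = 2 ^ 2 by norm_num, Real.sqrt_sq (by norm_num)]]
    exact Real.sqrt_lt_sqrt (by norm_num) (by norm_num)
  have hρ'ρ : ρ' < ρ := by
    have : k * Real.sqrt 2 < k * 2 := by nlinarith
    rw [hρ']; linarith
  have hball' : ball c ρ' ⊆ e₀.target := (ball_subset_ball hρ'ρ.le).trans hballρ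
  set i : EuclideanSpace ℝ (Fin 4) → X := e₀.symm ∘ univBall c ρ' with hi
  have hiemb : Manifold.IsSmoothEmbedding (𝓡 4) (𝓡 4) ∞ i :=
    isSmoothEmbedding_chart_symm_comp_univBall x₀ c hρ'0 hball'
  -- values and derivative of the disc on the unit sphere
  have hval : ∀ u : EuclideanSpace ℝ (Fin 4), ‖u‖ = 1 → univBall c ρ' u = c + k • u := by
    intro u hu; rw [univBall_apply_of_norm_eq_one c hρ'0 hu, hkρ']
  have hmemt : ∀ u : EuclideanSpace ℝ (Fin 4), ‖u‖ = 1 → c + k • u ∈ (extChartAt (𝓡 4) x₀).target := by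
    intro u hu
    rw [htarget]
    apply hballρ
    rw [mem_ball, dist_eq_norm, add_sub_cancel_left, norm_smul, Real.norm_eq_abs, abs_of_pos hk0, hu,
      mul_one]
    linarith
  have hmf : ∀ u : EuclideanSpace ℝ (Fin 4), ‖u‖ = 1 → ∀ v : EuclideanSpace ℝ (Fin 4), ⟪v, u⟫ = 0 →
      (mfderiv (𝓡 4) (𝓡 4) i u v : EuclideanSpace ℝ (Fin 4)) =
        k • (mfderiv (𝓡 4) (𝓡 4) (extChartAt (𝓡 4) x₀).symm (univBall c ρ' u) v :
          EuclideanSpace ℝ (Fin 4)) := by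
    intro u hu v hvu
    have hUd : MDifferentiableAt (𝓡 4) (𝓡 4) (univBall c ρ') u :=
      (contDiff_univBall (c := c) (r := ρ') (n := ⊤)).contMDiff.mdifferentiableAt (by simp)
    have hy : univBall c ρ' u ∈ (extChartAt (𝓡 4) x₀).target := by rw [hval u hu]; exact hmemt u hu
    have hEd : MDifferentiableAt (𝓡 4) (𝓡 4) (extChartAt (𝓡 4) x₀).symm (univBall c ρ' u) :=
      (contMDiffOn_extChartAt_symm (n := ∞) x₀ _ hy).mdifferentiableWithinAt (by simp) |>.mdifferentiableAt
        ((isOpen_extChartAt_target x₀).mem_nhds hy)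
    have hcomp : i = (extChartAt (𝓡 4) x₀).symm ∘ univBall c ρ' := by
      funext y; rw [hi, Function.comp_apply, Function.comp_apply, hsymm]
    have hB : (mfderiv (𝓡 4) (𝓡 4) (univBall c ρ') u v : EuclideanSpace ℝ (Fin 4)) = k • v := by
      rw [mfderiv_eq_fderiv]
      have h := fderiv_univBall_of_inner_eq_zero c hρ'0 hu hvu
      rw [hkρ'] at h
      exact h
    rw [hcomp, mfderiv_comp u hEd hUd]
    change (mfderiv (𝓡 4) (𝓡 4) (↑(extChartAt (𝓡 4) x₀).symm) (univBall c ρ' u))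
        ((mfderiv (𝓡 4) (𝓡 4) (↑(univBall c ρ')) u) v) = _
    rw [hB]
    exact map_smul (mfderiv (𝓡 4) (𝓡 4) (↑(extChartAt (𝓡 4) x₀).symm) (univBall c ρ' u)) k v
  -- the trace identity on the unit sphere
  have hbridge : ∀ (p q : X) (hpq : p = q) (a b : EuclideanSpace ℝ (Fin 4)),
      Ω p ![a, b] = Ω q ![a, b] := by
    intro p q hpq a b; subst hpq; rfl
  have htrace : ∀ u : EuclideanSpace ℝ (Fin 4), ‖u‖ = 1 → ∀ v w : EuclideanSpace ℝ (Fin 4),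
      ⟪v, u⟫ = 0 → ⟪w, u⟫ = 0 →
      Ω (i u) ![mfderiv (𝓡 4) (𝓡 4) i u v, mfderiv (𝓡 4) (𝓡 4) i u w] =
        k ^ 2 * Ωc (c + k • u) ![v, w] := by
    intro u hu v w hvu hwu
    set y : EuclideanSpace ℝ (Fin 4) := univBall c ρ' u with hy
    have hyt : y ∈ (extChartAt (𝓡 4) x₀).target := by rw [hy, hval u hu]; exact hmemt u hu
    have hiu : i u = (extChartAt (𝓡 4) x₀).symm y := by
      rw [hi, Function.comp_apply, hsymm]
    set D := mfderiv (𝓡 4) (𝓡 4) (extChartAt (𝓡 4) x₀).symm y with hD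
    set Ω' : (EuclideanSpace ℝ (Fin 4)) [⋀^Fin 2]→L[ℝ] ℝ := Ω ((extChartAt (𝓡 4) x₀).symm y) with hΩ'
    have h4 : Ω' ![D v, D w] = Ωc y ![v, w] := happly y hyt v w
    have hv' : (mfderiv (𝓡 4) (𝓡 4) i u v : EuclideanSpace ℝ (Fin 4)) = k • (D v : EuclideanSpace ℝ (Fin 4)) :=
      hmf u hu v hvu
    have hw' : (mfderiv (𝓡 4) (𝓡 4) i u w : EuclideanSpace ℝ (Fin 4)) = k • (D w : EuclideanSpace ℝ (Fin 4)) :=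
      hmf u hu w hwu
    have step1 : Ω (i u) ![mfderiv (𝓡 4) (𝓡 4) i u v, mfderiv (𝓡 4) (𝓡 4) i u w] =
        Ω (i u) ![k • (D v : EuclideanSpace ℝ (Fin 4)), k • (D w : EuclideanSpace ℝ (Fin 4))] :=
      two_form_congr_vec' Ω (i u) _ _ _ _ hv' hw'
    have step2 : Ω (i u) ![k • (D v : EuclideanSpace ℝ (Fin 4)), k • (D w : EuclideanSpace ℝ (Fin 4))] =
        Ω' ![k • (D v : EuclideanSpace ℝ (Fin 4)), k • (D w : EuclideanSpace ℝ (Fin 4))] :=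
      hbridge _ _ hiu _ _
    have s1 := two_form_smul_left Ω' k (D v) (k • (D w : EuclideanSpace ℝ (Fin 4)))
    have s2 := two_form_smul_right Ω' k (D v) (D w)
    have hyc : y = c + k • u := by rw [hy, hval u hu]
    calc Ω (i u) ![mfderiv (𝓡 4) (𝓡 4) i u v, mfderiv (𝓡 4) (𝓡 4) i u w]
        = Ω' ![k • (D v : EuclideanSpace ℝ (Fin 4)), k • (D w : EuclideanSpace ℝ (Fin 4))] := step1.trans step2
      _ = k * Ω' ![D v, k • (D w : EuclideanSpace ℝ (Fin 4))] := s1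
      _ = k * (k * Ω' ![D v, D w]) := congrArg (fun z : ℝ => k * z) s2
      _ = k ^ 2 * Ωc (c + k • u) ![v, w] := by rw [h4, hyc]; ring
  -- conclusion
  refine ⟨i, θ, hiemb, ?_, ?_⟩
  · -- `i 0 = x₀`
    change e₀.symm (univBall c ρ' 0) = x₀
    rw [univBall_apply_zero]
    exact e₀.left_inv (mem_chart_source _ x₀)
  · exact helper_isStabilising_of_tangential_eq_smul
      (fun u v w => Ωc (c + k • u) ![v, w])
      (fun u v w => Ω (i u) ![mfderiv (𝓡 4) (𝓡 4) i u v, mfderiv (𝓡 4) (𝓡 4) i u w])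
      θ (k ^ 2) (by positivity) (fun u hu v w hvu hwu => htrace u hu v w hvu hwu) ⟨hθ, h1, h2⟩

/-! ### SR at seams bounding a ball -/

/-- A reflection of `ℝ⁴`: a linear isometry `ρ` with `det ρ < 0` and `ρ ∘ ρ = id`
(Mathlib's `Submodule.reflection` in a coordinate hyperplane). [folklore] -/
theorem exists_linearIsometryEquiv_reflection_four :
    ∃ ρ : EuclideanSpace ℝ (Fin 4) ≃ₗᵢ[ℝ] EuclideanSpace ℝ (Fin 4),
      LinearMap.det (ρ.toContinuousLinearEquiv.toLinearEquiv :
          EuclideanSpace ℝ (Fin 4) →ₗ[ℝ] EuclideanSpace ℝ (Fin 4)) < 0 ∧ ∀ x, ρ (ρ x) = x := by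
  set v : EuclideanSpace ℝ (Fin 4) := EuclideanSpace.single 0 1 with hv
  have hv0 : v ≠ 0 := fun h => by
    have := congrArg (fun w : EuclideanSpace ℝ (Fin 4) => w 0) h
    simp [hv] at this
  set K : Submodule ℝ (EuclideanSpace ℝ (Fin 4)) := (ℝ ∙ v)ᗮ with hK
  refine ⟨K.reflection, ?_, fun x => K.reflection_reflection x⟩
  have h1 : LinearMap.det (K.reflection.toContinuousLinearEquiv.toLinearEquiv :
      EuclideanSpace ℝ (Fin 4) →ₗ[ℝ] EuclideanSpace ℝ (Fin 4)) =
        LinearMap.det K.reflection.toLinearMap := rfl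
  rw [h1, Submodule.det_reflection, hK, Submodule.orthogonal_orthogonal, finrank_span_singleton hv0]
  norm_num

/-- Congruence of the seam trace of two maps `ℝ⁴ → X` at a point where their values and their
differentials agree. [folklore] -/
theorem trace_congr {X : Type} [TopologicalSpace X] [ChartedSpace (EuclideanSpace ℝ (Fin 4)) X]
    (Ω : Literature.Geometry.Kaehler.MForm (𝓡 4) X ℝ 2) (h₁ h₂ : EuclideanSpace ℝ (Fin 4) → X)
    (u : EuclideanSpace ℝ (Fin 4)) (hp : h₁ u = h₂ u)
    (hd : mfderiv 𝓘(ℝ, EuclideanSpace ℝ (Fin 4)) (𝓡 4) h₁ u =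
      mfderiv 𝓘(ℝ, EuclideanSpace ℝ (Fin 4)) (𝓡 4) h₂ u)
    (v w : EuclideanSpace ℝ (Fin 4)) :
    Ω (h₁ u) ![mfderiv (𝓡 4) (𝓡 4) h₁ u v, mfderiv (𝓡 4) (𝓡 4) h₁ u w] =
      Ω (h₂ u) ![mfderiv (𝓡 4) (𝓡 4) h₂ u v, mfderiv (𝓡 4) (𝓡 4) h₂ u w] := by
  have hbridge : ∀ (p q : X), p = q → ∀ a b : EuclideanSpace ℝ (Fin 4),
      Ω p ![a, b] = Ω q ![a, b] := by
    intro p q hpq a b; subst hpq; rfl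
  have e1 : (mfderiv (𝓡 4) (𝓡 4) h₁ u v : EuclideanSpace ℝ (Fin 4)) = mfderiv (𝓡 4) (𝓡 4) h₂ u v :=
    congrArg (fun L : TangentSpace 𝓘(ℝ, EuclideanSpace ℝ (Fin 4)) u →L[ℝ]
      TangentSpace (𝓡 4) (h₁ u) => (L v : EuclideanSpace ℝ (Fin 4))) hd
  have e2 : (mfderiv (𝓡 4) (𝓡 4) h₁ u w : EuclideanSpace ℝ (Fin 4)) = mfderiv (𝓡 4) (𝓡 4) h₂ u w :=
    congrArg (fun L : TangentSpace 𝓘(ℝ, EuclideanSpace ℝ (Fin 4)) u →L[ℝ]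
      TangentSpace (𝓡 4) (h₁ u) => (L w : EuclideanSpace ℝ (Fin 4))) hd
  calc Ω (h₁ u) ![mfderiv (𝓡 4) (𝓡 4) h₁ u v, mfderiv (𝓡 4) (𝓡 4) h₁ u w]
      = Ω (h₁ u) ![(mfderiv (𝓡 4) (𝓡 4) h₂ u v : EuclideanSpace ℝ (Fin 4)),
          (mfderiv (𝓡 4) (𝓡 4) h₂ u w : EuclideanSpace ℝ (Fin 4))] := by rw [← e1, ← e2]
    _ = Ω (h₂ u) ![mfderiv (𝓡 4) (𝓡 4) h₂ u v, mfderiv (𝓡 4) (𝓡 4) h₂ u w] :=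
          hbridge _ _ hp _ _


/-- **SR HOLDS AT EVERY SEAM THAT BOUNDS A SMOOTHLY EMBEDDED BALL** (registered helper; the known
rung of `stub_stableRepresentative`): for a symplectic `MForm` `Ω` on a connected `ℝ⁴`-charted `X`
and every DISC `G : ℝ⁴ → X` there are `φ : X ≅ X` and a global smooth `θ` such that the trace of
`φ ∘ G` on the unit sphere satisfies the two stability clauses.  Unoriented disc theorem (Palais
1960 Thm B / Hirsch 8.3.1) onto the stable disc of `helper_exists_stable_disc`; traces agree on the
sphere; reflected data transport along `ρ`. [cite: Palais1960, Thm. B] -/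
theorem helper_stableRepresentative_of_disc :
    ∀ (X : Type) [TopologicalSpace X] [T2Space X] [ConnectedSpace X] [ChartedSpace (EuclideanSpace ℝ (Fin 4)) X] [IsManifold (𝓡 4) ∞ X] (Ω : Literature.Geometry.Kaehler.MForm (𝓡 4) X ℝ 2) (G : EuclideanSpace ℝ (Fin 4) → X), (Literature.Geometry.Kaehler.IsSmoothForm Ω ∧ Literature.Geometry.Kaehler.IsClosedForm Ω ∧ ∀ x (v : TangentSpace (𝓡 4) x), v ≠ 0 → ∃ w, Ω x ![v, w] ≠ 0) → Manifold.IsSmoothEmbedding (𝓡 4) (𝓡 4) ∞ G → ∃ (φ : X ≃ₘ⟮𝓡 4, 𝓡 4⟯ X) (θ : EuclideanSpace ℝ (Fin 4) → EuclideanSpace ℝ (Fin 4) →L[ℝ] ℝ), (ContDiff ℝ ∞ θ ∧ (∀ u : EuclideanSpace ℝ (Fin 4), ‖u‖ = 1 → ∀ v : Fin 3 → EuclideanSpace ℝ (Fin 4), (∀ i, ⟪v i, u⟫ = 0) → LinearIndependent ℝ v → θ u (v 0) * Ω ((φ ∘ G) u) ![mfderiv (𝓡 4) (𝓡 4) (φ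 ∘ G) u (v 1), mfderiv (𝓡 4) (𝓡 4) (φ ∘ G) u (v 2)] - θ u (v 1) * Ω ((φ ∘ G) u) ![mfderiv (𝓡 4) (𝓡 4) (φ ∘ G) u (v 0), mfderiv (𝓡 4) (𝓡 4) (φ ∘ G) u (v 2)] + θ u (v 2) * Ω ((φ ∘ G) u) ![mfderiv (𝓡 4) (𝓡 4) (φ ∘ G) u (v 0), mfderiv (𝓡 4) (𝓡 4) (φ ∘ G) u (v 1)] ≠ 0) ∧ (∀ u : EuclideanSpace ℝ (Fin 4), ‖u‖ = 1 → ∀ v : EuclideanSpace ℝ (Fin 4), ⟪v, u⟫ = 0 → (∀ w : EuclideanSpace ℝ (Fin 4), ⟪w, u⟫ = 0 → Ω ((φ ∘ G) u) ![mfderiv (𝓡 4) (𝓡 4) (φ ∘ G) u v, mfderiv (𝓡 4) (𝓡 4) (φ ∘ G) u w] = 0) → ∀ w : EuclideanSpace ℝ (Fin 4), ⟪w, u⟫ = 0 → fderiv ℝ θ u v w - fderiv ℝ θ u w v = 0)) := by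
  intro X _ _ _ _ _ Ω G hΩ hG
  -- the stable disc at `G 0` and a reflection
  obtain ⟨i, θ, hi, -, hstab⟩ := helper_exists_stable_disc X Ω hΩ (G 0)
  obtain ⟨ρ, hρdet, hρρ⟩ := exists_linearIsometryEquiv_reflection_four
  -- the unoriented disc theorem
  obtain ⟨f, hf⟩ := exists_diffeomorph_apply_disc_eq_or_reflect_of_model (I := 𝓡 4)
    (by simp) hG hi ρ.toContinuousLinearEquiv hρdet
  -- differentiability of the maps involved, on the unit sphere
  have hfG : ∀ u : EuclideanSpace ℝ (Fin 4),
      MDifferentiableAt 𝓘(ℝ, EuclideanSpace ℝ (Fin 4)) (𝓡 4) (⇑f ∘ G) u := fun u =>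
    (f.contMDiff.comp hG.contMDiff).mdifferentiableAt (by simp)
  have hid : ∀ u : EuclideanSpace ℝ (Fin 4),
      MDifferentiableAt 𝓘(ℝ, EuclideanSpace ℝ (Fin 4)) (𝓡 4) i u := fun u =>
    hi.contMDiff.mdifferentiableAt (by simp)
  have hρd : ContMDiff (𝓡 4) (𝓡 4) ∞ (⇑ρ : EuclideanSpace ℝ (Fin 4) → EuclideanSpace ℝ (Fin 4)) :=
    ρ.toContinuousLinearEquiv.contDiff.contMDiff
  have hiρ : ∀ u : EuclideanSpace ℝ (Fin 4),
      MDifferentiableAt 𝓘(ℝ, EuclideanSpace ℝ (Fin 4)) (𝓡 4) (i ∘ ⇑ρ) u := fun u =>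
    (hi.contMDiff.comp hρd).mdifferentiableAt (by simp)
  -- the derivative of `i ∘ ρ`
  have hmfρ : ∀ u v : EuclideanSpace ℝ (Fin 4),
      mfderiv (𝓡 4) (𝓡 4) (i ∘ ⇑ρ) u v = mfderiv (𝓡 4) (𝓡 4) i (ρ u) (ρ v) := by
    intro u v
    have hρm : MDifferentiableAt (𝓡 4) (𝓡 4) (⇑ρ : EuclideanSpace ℝ (Fin 4) → _) u :=
      hρd.mdifferentiableAt (by simp)
    rw [mfderiv_comp u (hid (ρ u)) hρm]
    change (mfderiv (𝓡 4) (𝓡 4) i (ρ u)) ((mfderiv (𝓡 4) (𝓡 4) (⇑ρ) u) v) = _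
    have hρv : (mfderiv (𝓡 4) (𝓡 4) (⇑ρ) u v : EuclideanSpace ℝ (Fin 4)) = ρ v := by
      rw [mfderiv_eq_fderiv]
      exact congrFun (congrArg DFunLike.coe ρ.toContinuousLinearEquiv.fderiv) v
    rw [hρv]
  rcases hf with hf | hf
  · -- case `f ∘ G = i` on the closed unit ball
    refine ⟨f, θ, ?_⟩
    have heq : ∀ u ∈ closedBall (0 : EuclideanSpace ℝ (Fin 4)) 1, (⇑f ∘ G) u = i u :=
      fun u hu => hf u (mem_closedBall_zero_iff.1 hu)
    have hmf : ∀ u ∈ sphere (0 : EuclideanSpace ℝ (Fin 4)) 1,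
        mfderiv 𝓘(ℝ, EuclideanSpace ℝ (Fin 4)) (𝓡 4) (⇑f ∘ G) u =
          mfderiv 𝓘(ℝ, EuclideanSpace ℝ (Fin 4)) (𝓡 4) i u :=
      helper_mfderiv_eq_of_eqOn_closedBall X (⇑f ∘ G) i heq (fun u _ => hfG u) (fun u _ => hid u)
    have htr : ∀ u : EuclideanSpace ℝ (Fin 4), ‖u‖ = 1 → ∀ v w : EuclideanSpace ℝ (Fin 4),
        ⟪v, u⟫ = 0 → ⟪w, u⟫ = 0 →
        Ω ((⇑f ∘ G) u) ![mfderiv (𝓡 4) (𝓡 4) (⇑f ∘ G) u v, mfderiv (𝓡 4) (𝓡 4) (⇑f ∘ G) u w] =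
          1 * Ω (i u) ![mfderiv (𝓡 4) (𝓡 4) i u v, mfderiv (𝓡 4) (𝓡 4) i u w] := by
      intro u hu v w _ _
      rw [one_mul]
      exact trace_congr Ω (⇑f ∘ G) i u (heq u (by simp [hu])) (hmf u (by simp [hu])) v w
    exact helper_isStabilising_of_tangential_eq_smul
      (fun u v w => Ω (i u) ![mfderiv (𝓡 4) (𝓡 4) i u v, mfderiv (𝓡 4) (𝓡 4) i u w])
      (fun u v w => Ω ((⇑f ∘ G) u) ![mfderiv (𝓡 4) (𝓡 4) (⇑f ∘ G) u v,
        mfderiv (𝓡 4) (𝓡 4) (⇑f ∘ G) u w])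
      θ 1 one_ne_zero htr hstab
  · -- case `f ∘ G ∘ ρ = i` on the closed unit ball, i.e. `f ∘ G = i ∘ ρ` there
    refine ⟨f, fun u => (θ (ρ u)).comp
      (ρ.toContinuousLinearEquiv : EuclideanSpace ℝ (Fin 4) →L[ℝ] EuclideanSpace ℝ (Fin 4)), ?_⟩
    have heq : ∀ u ∈ closedBall (0 : EuclideanSpace ℝ (Fin 4)) 1, (⇑f ∘ G) u = (i ∘ ⇑ρ) u := by
      intro u hu
      have h := hf (ρ u) (by rw [ρ.norm_map]; exact mem_closedBall_zero_iff.1 hu)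
      have e : (ρ.toContinuousLinearEquiv : EuclideanSpace ℝ (Fin 4) → EuclideanSpace ℝ (Fin 4)) (ρ u) = u :=
        hρρ u
      simp only [Function.comp_apply] at h ⊢
      rw [e] at h
      exact h
    have hmf : ∀ u ∈ sphere (0 : EuclideanSpace ℝ (Fin 4)) 1,
        mfderiv 𝓘(ℝ, EuclideanSpace ℝ (Fin 4)) (𝓡 4) (⇑f ∘ G) u =
          mfderiv 𝓘(ℝ, EuclideanSpace ℝ (Fin 4)) (𝓡 4) (i ∘ ⇑ρ) u :=
      helper_mfderiv_eq_of_eqOn_closedBall X (⇑f ∘ G) (i ∘ ⇑ρ) heq (fun u _ => hfG u)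
        (fun u _ => hiρ u)
    -- transported stability data
    have hstabρ := helper_isStabilising_comp_linearIsometry
      (fun u v w => Ω (i u) ![mfderiv (𝓡 4) (𝓡 4) i u v, mfderiv (𝓡 4) (𝓡 4) i u w]) θ ρ hstab
    have htr : ∀ u : EuclideanSpace ℝ (Fin 4), ‖u‖ = 1 → ∀ v w : EuclideanSpace ℝ (Fin 4),
        ⟪v, u⟫ = 0 → ⟪w, u⟫ = 0 →
        Ω ((⇑f ∘ G) u) ![mfderiv (𝓡 4) (𝓡 4) (⇑f ∘ G) u v, mfderiv (𝓡 4) (𝓡 4) (⇑f ∘ G) u w] =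
          1 * Ω (i (ρ u)) ![mfderiv (𝓡 4) (𝓡 4) i (ρ u) (ρ v), mfderiv (𝓡 4) (𝓡 4) i (ρ u) (ρ w)] := by
      intro u hu v w _ _
      rw [one_mul]
      exact (trace_congr Ω (⇑f ∘ G) (i ∘ ⇑ρ) u (heq u (by simp [hu])) (hmf u (by simp [hu])) v w).trans
        (two_form_congr_vec' Ω (i (ρ u)) _ _ _ _ (hmfρ u v) (hmfρ u w))
    exact helper_isStabilising_of_tangential_eq_smul
      (fun u v w => Ω (i (ρ u)) ![mfderiv (𝓡 4) (𝓡 4) i (ρ u) (ρ v), mfderiv (𝓡 4) (𝓡 4) i (ρ u) (ρ w)])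
      (fun u v w => Ω ((⇑f ∘ G) u) ![mfderiv (𝓡 4) (𝓡 4) (⇑f ∘ G) u v,
        mfderiv (𝓡 4) (𝓡 4) (⇑f ∘ G) u w])
      _ 1 one_ne_zero htr hstabρ

end Summit.SmoothPoincare4.SmoothPoincare4.Theorems.OrigamiFoldExistence.StableSeamHost

end
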